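import Summits.RiemannHypothesis.RiemannHypothesis.Theorems.PfPersistenceMarkovCore
import HarnessLib

/-!
# PF persistence (theory 1, edge law): THE MARKOV CORE OF A NON-NEGATIVE WEIGHT TABLE, II —
# uniqueness and evenness of the non-negative minimiser; phase rigidity

Helper file (`--supports stmt-RiemannHypothesis-19953`); mechanism/rigidity campaign; no RH claims.
Second of four files on kernel Perron–Frobenius for the Markov core `𝓔^w_a = tableDirichletEnergy a w`
of EVERY non-negative weight table at EVERY window (see `PfPersistenceMarkovCore` for the objects).

* `core_nonneg_minimizer_ae_eq` — two non-negative normalised minimisers of `𝓔^w_a` over the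
  finite-energy class of the window coincide a.e. (convexity of `ρ ↦ 𝓔(√ρ)`: the pair deficit
  `(Φ₀(x)Φ₁(y) − Φ₁(x)Φ₀(y))²` is charged by the archimedean density at every length);
* `core_nonneg_minimizer_even` — the non-negative minimiser is even a.e. (reflection invariance);
* `core_phase_rigidity` — a minimiser with `|u| > 0` a.e. on `(-a, a)` is `c|u|` a.e., `|c| = 1`
  (`|u(y) − u(x)| = ||u(y)| − |u(x)||` for a.e. pair).

The tree's `nonneg_minimizer_ae_eq`, `nonneg_minimizer_even`, `phase_rigidity` (route WeilGroundState,
item `MarkovPartPositiveGroundState`) are the case `w = Λ(n)/√n`; the proofs are theirs, with the prime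
sum entering only through `w(n) ≥ 0` (`table_lintegral_deficit_le`).

## References

* M. Reed, B. Simon, *Methods of Modern Mathematical Physics IV* (1978), §XIII.12, Thms XIII.43–44.
* Z.-Q. Chen, M. Fukushima, *Symmetric Markov Processes, Time Change, and Boundary Theory* (2012),
  §1.1 Def. 1.1.2, Thm 1.1.3(e) (normal contractions operate on a Dirichlet form).
* E. H. Lieb, M. Loss, *Analysis*, 2nd ed. (2001), Thm 7.8 (convexity of the energy in the density).
* E. Bombieri, Rend. Mat. Acc. Lincei (9) 11 (2000) 183–233, Thm 2 (the windowed explicit formula).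
-/

set_option linter.dupNamespace false

noncomputable section

open MeasureTheory Set Filter
open scoped Topology ENNReal NNReal ComplexConjugate

namespace Summit.RiemannHypothesis.RiemannHypothesis.Theorems.PfPersistence

open Literature.NumberTheory.LFunctions
open Summit.RiemannHypothesis.RiemannHypothesis.Theorems.WeilWindowFlowWindowLipschitz
  (stub_localizedCut_aesm_weilIncrement)
open Summit.RiemannHypothesis.RiemannHypothesis.Theorems.WeilGroundStateMarkovPart
open Summit.RiemannHypothesis.RiemannHypothesis.Theorems.PfPersistenceDownCone (zetaTable)

/-! ## §4 Uniqueness and evenness of the non-negative minimiser -/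

/-- **Uniqueness of the non-negative minimiser of the core of a non-negative table** (Perron–Frobenius,
uniqueness half; the tree's `nonneg_minimizer_ae_eq` is the case `w = Λ(n)/√n`). Let `E` be a lower
bound of `𝓔^w_a` on the finite-energy class of the window (`E ∫|v|² ≤ 𝓔^w_a(v)`) and `Φ₀, Φ₁ ≥ 0`
measurable, square integrable, vanishing off `[-a, a]`, normalised, of finite archimedean energy and
of energy `≤ E`. Then `Φ₀ = Φ₁` a.e. [cite: ReedSimonIV1978, §XIII.12 Thm XIII.44] -/
theorem core_nonneg_minimizer_ae_eq {a E : ℝ} {w : ℕ → ℝ} (hw : ∀ n ∈ weilPrimeIndex a, 0 ≤ w n)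
    {Φ₀ Φ₁ : ℝ → ℝ}
    (hm₀ : Measurable Φ₀) (hm₁ : Measurable Φ₁) (h₀ : ∀ x, 0 ≤ Φ₀ x) (h₁ : ∀ x, 0 ≤ Φ₁ x)
    (hL₀ : MemLp Φ₀ 2) (hL₁ : MemLp Φ₁ 2)
    (hs₀ : ∀ x, x ∉ Icc (-a) a → Φ₀ x = 0) (hs₁ : ∀ x, x ∉ Icc (-a) a → Φ₁ x = 0)
    (hn₀ : ∫ x, Φ₀ x ^ 2 = 1) (hn₁ : ∫ x, Φ₁ x ^ 2 = 1)
    (hfin₀ : IntegrableOn (fun t ↦ weilArchDensity t * weilIncrement (fun x ↦ (Φ₀ x : ℂ)) t)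
      (Ioi 0))
    (hfin₁ : IntegrableOn (fun t ↦ weilArchDensity t * weilIncrement (fun x ↦ (Φ₁ x : ℂ)) t)
      (Ioi 0))
    (hE₀ : tableDirichletEnergy a w (fun x ↦ (Φ₀ x : ℂ)) ≤ E)
    (hE₁ : tableDirichletEnergy a w (fun x ↦ (Φ₁ x : ℂ)) ≤ E)
    (hbot : ∀ v : ℝ → ℂ, MemLp v 2 → (∀ x, x ∉ Icc (-a) a → v x = 0) →
      IntegrableOn (fun t ↦ weilArchDensity t * weilIncrement v t) (Ioi 0) →
      E * ∫ x, ‖v x‖ ^ 2 ≤ tableDirichletEnergy a w v) :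
    Φ₀ =ᵐ[volume] Φ₁ := by
  -- the square-root mean and the deficit
  set M : ℝ → ℝ := fun x ↦ Real.sqrt (1 * Φ₀ x ^ 2 + 1 * Φ₁ x ^ 2) with hMdef
  set F : ℝ → ℝ → ℝ := fun x y ↦
    2 * (M x * M y - (1 * Φ₀ x * Φ₀ y + 1 * Φ₁ x * Φ₁ y)) with hFdef
  have hF0 : ∀ x y, 0 ≤ F x y := fun x y ↦
    mul_nonneg zero_le_two (geomMean_deficit_nonneg zero_le_one zero_le_one)
  have hFsymm : ∀ x y, F x y = F y x := fun x y ↦ by simp only [hFdef]; ring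
  have hMm : Measurable M := by
    simp only [hMdef]
    exact ((measurable_const.mul (hm₀.pow_const 2)).add
      (measurable_const.mul (hm₁.pow_const 2))).sqrt
  have hFm : Measurable (Function.uncurry F) := by
    have e : Function.uncurry F = fun p : ℝ × ℝ ↦
        2 * (M p.1 * M p.2 - (1 * Φ₀ p.1 * Φ₀ p.2 + 1 * Φ₁ p.1 * Φ₁ p.2)) := by
      funext p; rfl
    rw [e]
    have h1 : Measurable fun p : ℝ × ℝ ↦ M p.1 := hMm.comp measurable_fst
    have h2 : Measurable fun p : ℝ × ℝ ↦ M p.2 := hMm.comp measurable_snd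
    have h3 : Measurable fun p : ℝ × ℝ ↦ Φ₀ p.1 := hm₀.comp measurable_fst
    have h4 : Measurable fun p : ℝ × ℝ ↦ Φ₀ p.2 := hm₀.comp measurable_snd
    have h5 : Measurable fun p : ℝ × ℝ ↦ Φ₁ p.1 := hm₁.comp measurable_fst
    have h6 : Measurable fun p : ℝ × ℝ ↦ Φ₁ p.2 := hm₁.comp measurable_snd
    fun_prop
  -- the pointwise identity
  have hid : ∀ x y, ‖(M y : ℂ) - (M x : ℂ)‖ ^ 2 + F x y =
      1 * ‖(Φ₀ y : ℂ) - (Φ₀ x : ℂ)‖ ^ 2 + 1 * ‖(Φ₁ y : ℂ) - (Φ₁ x : ℂ)‖ ^ 2 := by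
    intro x y
    simp only [norm_ofReal_sub_sq, hFdef, hMdef]
    exact geomMean_sq_identity zero_le_one zero_le_one
  -- `L²` data
  have hL₀c : MemLp (fun x ↦ (Φ₀ x : ℂ)) 2 := hL₀.ofReal
  have hL₁c : MemLp (fun x ↦ (Φ₁ x : ℂ)) 2 := hL₁.ofReal
  have hi₀ : Integrable fun x ↦ Φ₀ x ^ 2 := by
    have := (memLp_two_iff_integrable_sq_norm hL₀.1).1 hL₀
    simpa only [Real.norm_eq_abs, sq_abs] using this
  have hi₁ : Integrable fun x ↦ Φ₁ x ^ 2 := by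
    have := (memLp_two_iff_integrable_sq_norm hL₁.1).1 hL₁
    simpa only [Real.norm_eq_abs, sq_abs] using this
  have hMsq : ∀ x, ‖(M x : ℂ)‖ ^ 2 = Φ₀ x ^ 2 + Φ₁ x ^ 2 := fun x ↦ by
    rw [Complex.norm_real, Real.norm_eq_abs, sq_abs, hMdef, Real.sq_sqrt (by positivity)]
    ring
  have hMc : MemLp (fun x ↦ (M x : ℂ)) 2 := by
    refine (memLp_two_iff_integrable_sq_norm
      (Complex.measurable_ofReal.comp hMm).aestronglyMeasurable).2 ?_
    show Integrable (fun x ↦ ‖(M x : ℂ)‖ ^ 2)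
    exact (hi₀.add hi₁).congr (Eventually.of_forall fun x ↦ (hMsq x).symm)
  have hMnorm : ∫ x, ‖(M x : ℂ)‖ ^ 2 = 2 := by
    simp only [hMsq]
    rw [integral_add hi₀ hi₁, hn₀, hn₁]
    norm_num
  have hMs : ∀ x, x ∉ Icc (-a) a → (M x : ℂ) = 0 := fun x hx ↦ by
    simp only [hMdef, hs₀ x hx, hs₁ x hx]
    norm_num
  -- the energy deficit
  obtain ⟨hfinM, hdef⟩ := table_lintegral_deficit_le hw hMc hL₀c hL₁c hF0 hid hfin₀ hfin₁
  have hEM : E * 2 ≤ tableDirichletEnergy a w (fun x ↦ (M x : ℂ)) := by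
    have := hbot _ hMc hMs hfinM
    rwa [hMnorm] at this
  have hzero : ∫⁻ t in Ioi (0 : ℝ), ∫⁻ x, ENNReal.ofReal (weilArchDensity t * F x (x + t)) = 0 := by
    refine le_antisymm (hdef.trans ?_) bot_le
    rw [ENNReal.ofReal_of_nonpos (by linarith)]
  -- a.e. pair rigidity
  have hae : ∀ᵐ x : ℝ, ∀ᵐ y : ℝ, ENNReal.ofReal (F x y) = 0 :=
    ae_pair_eq_zero_of_ae_lintegral_shift (F := fun x y ↦ ENNReal.ofReal (F x y))
      (ENNReal.measurable_ofReal.comp hFm) (fun x y ↦ by rw [hFsymm])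
      (ae_lintegral_shift_eq_zero hFm hF0 hzero)
  have hcross : ∀ᵐ x : ℝ, ∀ᵐ y : ℝ, Φ₀ x * Φ₁ y = Φ₁ x * Φ₀ y := by
    filter_upwards [hae] with x hx
    filter_upwards [hx] with y hy
    have hF00 : F x y = 0 := le_antisymm (ENNReal.ofReal_eq_zero.1 hy) (hF0 x y)
    have h2 : M x * M y - (1 * Φ₀ x * Φ₀ y + 1 * Φ₁ x * Φ₁ y) = 0 := by
      simp only [hFdef] at hF00
      linarith
    have h3 := geomMean_cross_eq_zero zero_le_one zero_le_one h2
    have h4 : (Φ₀ x * Φ₁ y - Φ₁ x * Φ₀ y) ^ 2 = 0 := by linarith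
    exact sub_eq_zero.1 (pow_eq_zero_iff two_ne_zero |>.1 h4)
  -- integrate against `Φ₀(y)`
  set c : ℝ := ∫ y, Φ₀ y * Φ₁ y with hcdef
  have hi01 : Integrable fun y ↦ Φ₀ y * Φ₁ y := hL₀.integrable_mul hL₁
  have hprop : ∀ᵐ x : ℝ, Φ₁ x = c * Φ₀ x := by
    filter_upwards [hcross] with x hx
    have h1 : ∫ y, Φ₀ y * (Φ₀ x * Φ₁ y) = ∫ y, Φ₀ y * (Φ₁ x * Φ₀ y) :=
      integral_congr_ae (hx.mono fun y hy ↦ by simp only [hy])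
    have h2 : ∫ y, Φ₀ y * (Φ₀ x * Φ₁ y) = Φ₀ x * c := by
      rw [hcdef, ← integral_const_mul]
      exact integral_congr_ae (Eventually.of_forall fun y ↦ by ring)
    have h3 : ∫ y, Φ₀ y * (Φ₁ x * Φ₀ y) = Φ₁ x * 1 := by
      rw [← hn₀, ← integral_const_mul]
      exact integral_congr_ae (Eventually.of_forall fun y ↦ by ring)
    rw [h2, h3, mul_one] at h1
    linarith
  -- `c = 1`
  have hc0 : 0 ≤ c := integral_nonneg fun y ↦ mul_nonneg (h₀ y) (h₁ y)
  have hc1 : c ^ 2 = 1 := by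
    have h1 : ∫ x, Φ₁ x ^ 2 = ∫ x, c ^ 2 * Φ₀ x ^ 2 :=
      integral_congr_ae (hprop.mono fun x hx ↦ by simp only [hx]; ring)
    rw [integral_const_mul, hn₀, hn₁] at h1
    linarith
  have hc : c = 1 := by nlinarith
  filter_upwards [hprop] with x hx
  rw [hx, hc, one_mul]

/-- **The non-negative minimiser of the core is even**: `𝓔^w_a` and the window are reflection
invariant (`tableDirichletEnergy_comp_neg`), so uniqueness applies to `Φ(−·)`. [cite: ReedSimonIV1978, §XIII.12 Thm XIII.44] -/
theorem core_nonneg_minimizer_even {a E : ℝ} {w : ℕ → ℝ} (hw : ∀ n ∈ weilPrimeIndex a, 0 ≤ w n)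
    {Φ : ℝ → ℝ}
    (hm : Measurable Φ) (h0 : ∀ x, 0 ≤ Φ x) (hL : MemLp Φ 2)
    (hs : ∀ x, x ∉ Icc (-a) a → Φ x = 0) (hn : ∫ x, Φ x ^ 2 = 1)
    (hfin : IntegrableOn (fun t ↦ weilArchDensity t * weilIncrement (fun x ↦ (Φ x : ℂ)) t)
      (Ioi 0))
    (hE : tableDirichletEnergy a w (fun x ↦ (Φ x : ℂ)) ≤ E)
    (hbot : ∀ v : ℝ → ℂ, MemLp v 2 → (∀ x, x ∉ Icc (-a) a → v x = 0) →
      IntegrableOn (fun t ↦ weilArchDensity t * weilIncrement v t) (Ioi 0) →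
      E * ∫ x, ‖v x‖ ^ 2 ≤ tableDirichletEnergy a w v) :
    Φ =ᵐ[volume] fun x ↦ Φ (-x) := by
  have hm' : Measurable fun x ↦ Φ (-x) := hm.comp measurable_neg
  have hL' : MemLp (fun x ↦ Φ (-x)) 2 :=
    hL.comp_measurePreserving (Measure.measurePreserving_neg volume)
  have hs' : ∀ x, x ∉ Icc (-a) a → Φ (-x) = 0 := fun x hx ↦ hs (-x) fun h ↦ hx (by
    rcases h with ⟨h1, h2⟩
    exact ⟨by linarith, by linarith⟩)
  have hn' : ∫ x, Φ (-x) ^ 2 = 1 := by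
    rw [← hn]
    exact integral_neg_eq_self (fun x ↦ Φ x ^ 2) volume
  have hD : ∀ t, weilIncrement (fun x ↦ (Φ (-x) : ℂ)) t = weilIncrement (fun x ↦ (Φ x : ℂ)) t :=
    fun t ↦ weilIncrement_comp_neg (fun x ↦ (Φ x : ℂ)) t
  have hfin' : IntegrableOn
      (fun t ↦ weilArchDensity t * weilIncrement (fun x ↦ (Φ (-x) : ℂ)) t) (Ioi 0) := by
    simp only [hD]
    exact hfin
  have hE' : tableDirichletEnergy a w (fun x ↦ (Φ (-x) : ℂ)) ≤ E := by
    have h := tableDirichletEnergy_comp_neg a w (fun y ↦ (Φ y : ℂ))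
    exact (le_of_eq h).trans hE
  exact core_nonneg_minimizer_ae_eq hw hm hm' h0 (fun x ↦ h0 (-x)) hL hL' hs hs' hn hn' hfin hfin'
    hE hE' hbot

/-! ## §6 Phase rigidity; every minimiser is a unit multiple of the positive one -/

/-- **Phase rigidity of a core minimiser** (the tree's `phase_rigidity` for an arbitrary non-negative
table): a measurable normalised minimiser `u` of the core with `|u| > 0` a.e. on `(-a, a)` is
`c|u|` a.e. for a constant `|c| = 1` (`|u(y) − u(x)| = ||u(y)| − |u(x)||` for a.e. pair, i.e.
`u(y) conj u(x) ≥ 0`). [cite: ReedSimonIV1978, §XIII.12 Thm XIII.44] -/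
theorem core_phase_rigidity {a E : ℝ} {w : ℕ → ℝ} (hw : ∀ n ∈ weilPrimeIndex a, 0 ≤ w n)
    (ha : 0 < a) {u : ℝ → ℂ} (hum : Measurable u) (hu : MemLp u 2)
    (hs : ∀ x, x ∉ Icc (-a) a → u x = 0) (hn : ∫ x, ‖u x‖ ^ 2 = 1)
    (hfin : IntegrableOn (fun t ↦ weilArchDensity t * weilIncrement u t) (Ioi 0))
    (hE : tableDirichletEnergy a w u ≤ E)
    (hbot : ∀ v : ℝ → ℂ, MemLp v 2 → (∀ x, x ∉ Icc (-a) a → v x = 0) →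
      IntegrableOn (fun t ↦ weilArchDensity t * weilIncrement v t) (Ioi 0) →
      E * ∫ x, ‖v x‖ ^ 2 ≤ tableDirichletEnergy a w v)
    (hpos : ∀ᵐ x : ℝ, x ∈ Ioo (-a) a → 0 < ‖u x‖) :
    ∃ c : ℂ, ‖c‖ = 1 ∧ u =ᵐ[volume] fun x ↦ c * ((‖u x‖ : ℝ) : ℂ) := by
  -- the modulus and the deficit
  set M : ℝ → ℂ := fun x ↦ ((‖u x‖ : ℝ) : ℂ) with hMdef
  set F : ℝ → ℝ → ℝ := fun x y ↦ ‖u y - u x‖ ^ 2 - (‖u y‖ - ‖u x‖) ^ 2 with hFdef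
  have hF0 : ∀ x y, 0 ≤ F x y := fun x y ↦ by
    simp only [hFdef, sub_nonneg]
    have h := abs_norm_sub_norm_le (u y) (u x)
    calc (‖u y‖ - ‖u x‖) ^ 2 = |‖u y‖ - ‖u x‖| ^ 2 := (sq_abs _).symm
      _ ≤ ‖u y - u x‖ ^ 2 := pow_le_pow_left₀ (abs_nonneg _) h 2
  have hFsymm : ∀ x y, F x y = F y x := fun x y ↦ by
    simp only [hFdef, norm_sub_rev (u y) (u x)]
    ring
  have hFm : Measurable (Function.uncurry F) := by
    have e : Function.uncurry F = fun p : ℝ × ℝ ↦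
        ‖u p.2 - u p.1‖ ^ 2 - (‖u p.2‖ - ‖u p.1‖) ^ 2 := by
      funext p; rfl
    rw [e]
    have h1 : Measurable fun p : ℝ × ℝ ↦ u p.1 := hum.comp measurable_fst
    have h2 : Measurable fun p : ℝ × ℝ ↦ u p.2 := hum.comp measurable_snd
    fun_prop
  have hid : ∀ x y, ‖M y - M x‖ ^ 2 + F x y = 1 * ‖u y - u x‖ ^ 2 + 0 * ‖u y - u x‖ ^ 2 := by
    intro x y
    simp only [hMdef, hFdef]
    rw [← Complex.ofReal_sub, Complex.norm_real, Real.norm_eq_abs, sq_abs]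
    ring
  have hMc : MemLp M 2 := memLp_ofReal_norm hu
  have hMnorm : ∫ x, ‖M x‖ ^ 2 = 1 := by
    rw [← hn]
    refine integral_congr_ae (Eventually.of_forall fun x ↦ ?_)
    simp [hMdef]
  have hMs : ∀ x, x ∉ Icc (-a) a → M x = 0 := fun x hx ↦ by simp [hMdef, hs x hx]
  obtain ⟨hfinM, hdef⟩ := table_lintegral_deficit_le hw hMc hu hu hF0 hid hfin hfin
  have hEM : E * 1 ≤ tableDirichletEnergy a w M := by
    have := hbot _ hMc hMs hfinM
    rwa [hMnorm] at this
  have hzero : ∫⁻ t in Ioi (0 : ℝ), ∫⁻ x, ENNReal.ofReal (weilArchDensity t * F x (x + t)) = 0 := by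
    refine le_antisymm (hdef.trans ?_) bot_le
    rw [ENNReal.ofReal_of_nonpos (by linarith)]
  -- a.e. pairs: `u(y) conj u(x) ≥ 0`
  have hae : ∀ᵐ x : ℝ, ∀ᵐ y : ℝ, ENNReal.ofReal (F x y) = 0 :=
    ae_pair_eq_zero_of_ae_lintegral_shift (F := fun x y ↦ ENNReal.ofReal (F x y))
      (ENNReal.measurable_ofReal.comp hFm) (fun x y ↦ by rw [hFsymm])
      (ae_lintegral_shift_eq_zero hFm hF0 hzero)
  have hprod : ∀ᵐ x : ℝ, ∀ᵐ y : ℝ, u y * conj (u x) = (((‖u y‖ * ‖u x‖ : ℝ)) : ℂ) := by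
    filter_upwards [hae] with x hx
    filter_upwards [hx] with y hy
    have hF00 : F x y = 0 := le_antisymm (ENNReal.ofReal_eq_zero.1 hy) (hF0 x y)
    have hre : (u y * conj (u x)).re = ‖u y * conj (u x)‖ := by
      rw [norm_mul, Complex.norm_conj]
      have e1 : ‖u y - u x‖ ^ 2 = ‖u y‖ ^ 2 + ‖u x‖ ^ 2 - 2 * (u y * conj (u x)).re := by
        rw [← Complex.normSq_eq_norm_sq, ← Complex.normSq_eq_norm_sq, ← Complex.normSq_eq_norm_sq,
          Complex.normSq_sub]
      simp only [hFdef] at hF00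
      nlinarith [e1, hF00]
    have := eq_norm_of_re_eq_norm hre
    rw [this, norm_mul, Complex.norm_conj]
  -- a good base point
  obtain ⟨x₀, -, hx₀, hq⟩ : ∃ x₀ ∈ Ioo (-a) a, 0 < ‖u x₀‖ ∧
      ∀ᵐ y : ℝ, u y * conj (u x₀) = (((‖u y‖ * ‖u x₀‖ : ℝ)) : ℂ) := by
    by_contra hne
    have hne' : ∀ x ∈ Ioo (-a) a, 0 < ‖u x‖ →
        (∀ᵐ y : ℝ, u y * conj (u x) = (((‖u y‖ * ‖u x‖ : ℝ)) : ℂ)) → False :=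
      fun x hx h1 h2 ↦ hne ⟨x, hx, h1, h2⟩
    have hnull : volume (Ioo (-a) a) = 0 := by
      rw [measure_eq_zero_iff_ae_notMem]
      filter_upwards [hpos, hprod] with x hx1 hx2 hxI
      exact hne' x hxI (hx1 hxI) hx2
    rw [Real.volume_Ioo] at hnull
    have : (0 : ℝ) < a - -a := by linarith
    exact absurd hnull (ENNReal.ofReal_pos.2 this).ne'
  have hux₀ : conj (u x₀) ≠ 0 := by
    rw [map_ne_zero_iff _ (RingHom.injective _)]
    exact norm_pos_iff.1 hx₀
  refine ⟨((‖u x₀‖ : ℝ) : ℂ) / conj (u x₀), ?_, ?_⟩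
  · rw [norm_div, Complex.norm_conj, Complex.norm_real, Real.norm_of_nonneg (norm_nonneg _),
      div_self hx₀.ne']
  · filter_upwards [hq] with y hy
    calc u y = u y * conj (u x₀) / conj (u x₀) := by rw [mul_div_cancel_right₀ _ hux₀]
      _ = (((‖u y‖ * ‖u x₀‖ : ℝ)) : ℂ) / conj (u x₀) := by rw [hy]
      _ = ((‖u x₀‖ : ℝ) : ℂ) / conj (u x₀) * ((‖u y‖ : ℝ) : ℂ) := by
          push_cast
          ring

end Summit.RiemannHypothesis.RiemannHypothesis.Theorems.PfPersistence

end
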